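import Summits.MatrixMultiplication.MatrixMultiplication.Theorems.SoloInformedCwTwoBalancedFamily
import Summits.MatrixMultiplication.MatrixMultiplication.Theorems.SoloInformedCwTwoOnePairDesign
import Summits.MatrixMultiplication.MatrixMultiplication.Theorems.SoloInformedCwTwoOrientHall

/-!
# The alternation lemma: same-pair one-`sd` words have disjoint oriented candidate sets
(solo-informed seat, gen 14; CLAIMS c180 / c182 — the first structural constraint on forcing paths of the oriented SDR)

In a mixed design, take two distinct words `m ≠ m'` that both carry the mixed letter `s+d` (code `3`) at the SAME pair
`k` and plain letters (`0, s, d`) at every other pair.  If the two choices `ε k, ε' k` lie on the same side of an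
orientation at `k` (both in `{2s, s+d}` = the `T` side, or both in `{s+d, 2d}` = the `U` side), then the two candidate
values differ: `candVal s d t m ε ≠ candVal s d t m' ε'`.

Proof: the difference of the two candidate monomials has pair part in `{(0,0), (1,-1), (-1,1)}` at `k`, a difference of
two plain encodings `(0,0),(1,0),(0,1)` at every other pair, and singleton part in `{-1,0,1}` — so the relation AND its
negative are allowed, and a vanishing one is excluded by `IsMixedDesign.not_twoSigned`; it is nonzero because the words
are distinct.  Consequence (paper §2h(17)(c), ALTERNATION LEMMA): along a forcing path of the oriented system of distinct
representatives, consecutive internal one-`sd` words sit at different pairs; with the finite 'two-signed partial sum'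
enumeration this bounds plain forcing paths by 9 junctions (CLAIMS c182).

We also record the candidate value as an integer linear form in the digits (`candVal_cast`), reusable by later
certificate imports.
-/

namespace Summit.MatrixMultiplication.MatrixMultiplication.Theorems

open Finset

/-- `s`-coefficient of the candidate monomial of the letter `ℓ` under the choice `e` (only used when `ℓ = 3`). -/
def encS (ℓ : Fin 4) (e : Fin 3) : ℤ :=
  if ℓ = 3 then (![2, 1, 0] : Fin 3 → ℤ) e else (![0, 1, 0, 1] : Fin 4 → ℤ) ℓ

/-- `d`-coefficient of the candidate monomial of the letter `ℓ` under the choice `e`. -/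
def encD (ℓ : Fin 4) (e : Fin 3) : ℤ :=
  if ℓ = 3 then (![0, 1, 2] : Fin 3 → ℤ) e else (![0, 0, 1, 1] : Fin 4 → ℤ) ℓ

/-- The pair part of `candVal`, cast to `ℤ`, is the linear form with coefficients `encS, encD`. -/
lemma pairPart_cast (s d : ℕ) (ℓ : Fin 4) (e : Fin 3) :
    ((if ℓ = 3 then (![2 * s, s + d, 2 * d] : Fin 3 → ℕ) e
        else (![0, s, d, s + d] : Fin 4 → ℕ) ℓ : ℕ) : ℤ) = encS ℓ e * s + encD ℓ e * d := by
  fin_cases ℓ <;> fin_cases e <;> simp [encS, encD]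

/-- **Candidate values as an integer linear form in the digits.** -/
theorem candVal_cast {p q : ℕ} (s d : Fin p → ℕ) (t : Fin q → ℕ) (m : HWord p q) (ε : Fin p → Fin 3) :
    ((candVal s d t m ε : ℕ) : ℤ) =
      (∑ k, (encS (m.1 k) (ε k) * (s k : ℤ) + encD (m.1 k) (ε k) * (d k : ℤ))) + ∑ i, chiZ m.2 i * (t i : ℤ) := by
  have hsub := subsetSum_eq_chi t m.2
  simp only [subsetSum] at hsub
  unfold candVal
  rw [Nat.cast_add, Nat.cast_sum, hsub]
  congr 1
  exact Finset.sum_congr rfl (fun k _ => pairPart_cast (s k) (d k) (m.1 k) (ε k))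

/-- Both `(x, y)` and `(-x, -y)` are allowed pair patterns. -/
abbrev TwoSignedPair (x y : ℤ) : Prop :=
  (-1 ≤ x ∧ -1 ≤ y ∧ x + y ≤ 1) ∧ (-1 ≤ -x ∧ -1 ≤ -y ∧ -x + -y ≤ 1)

/-- Two plain letters: the difference of their encodings is two-signed. -/
lemma twoSignedPair_plain (ℓ ℓ' : Fin 4) (hℓ : ℓ ≠ 3) (hℓ' : ℓ' ≠ 3) (e e' : Fin 3) :
    TwoSignedPair (encS ℓ e - encS ℓ' e') (encD ℓ e - encD ℓ' e') := by
  fin_cases ℓ <;> fin_cases ℓ' <;> simp_all [TwoSignedPair, encS, encD]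

/-- Two mixed letters with both choices on the `T` side (`≠ 2d`): the difference is two-signed. -/
lemma twoSignedPair_T (e e' : Fin 3) (he : e ≠ 2) (he' : e' ≠ 2) :
    TwoSignedPair (encS 3 e - encS 3 e') (encD 3 e - encD 3 e') := by
  fin_cases e <;> fin_cases e' <;> simp_all [TwoSignedPair, encS, encD]

/-- Two mixed letters with both choices on the `U` side (`≠ 2s`): the difference is two-signed. -/
lemma twoSignedPair_U (e e' : Fin 3) (he : e ≠ 0) (he' : e' ≠ 0) :
    TwoSignedPair (encS 3 e - encS 3 e') (encD 3 e - encD 3 e') := by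
  fin_cases e <;> fin_cases e' <;> simp_all [TwoSignedPair, encS, encD]

/-- Plain encodings are injective on letters. -/
lemma plain_eq_of_enc_sub_eq_zero (ℓ ℓ' : Fin 4) (hℓ : ℓ ≠ 3) (hℓ' : ℓ' ≠ 3) (e e' : Fin 3)
    (h1 : encS ℓ e - encS ℓ' e' = 0) (h2 : encD ℓ e - encD ℓ' e' = 0) : ℓ = ℓ' := by
  fin_cases ℓ <;> fin_cases ℓ' <;> simp_all [encS, encD]

/-- **Alternation lemma (same-pair candidate sets are disjoint).**  In a mixed design, two distinct words with the mixed
letter at the same pair `k` and plain letters elsewhere have different candidate values whenever the two choices at `k`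
lie on the same side of an orientation (`T`: both `≠ 2`, i.e. in `{2s, s+d}`; `U`: both `≠ 0`, i.e. in `{s+d, 2d}`). -/
theorem IsMixedDesign.candVal_ne_of_samePair {p q : ℕ} {s d : Fin p → ℕ} {t : Fin q → ℕ}
    (hD : IsMixedDesign s d t) {m m' : HWord p q} (hne : m ≠ m') (k : Fin p)
    (hk : m.1 k = 3) (hk' : m'.1 k = 3) (hpl : ∀ j, j ≠ k → m.1 j ≠ 3) (hpl' : ∀ j, j ≠ k → m'.1 j ≠ 3)
    (ε ε' : Fin p → Fin 3) (hside : (ε k ≠ 2 ∧ ε' k ≠ 2) ∨ (ε k ≠ 0 ∧ ε' k ≠ 0)) :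
    candVal s d t m ε ≠ candVal s d t m' ε' := by
  classical
  intro heq
  have hpair : ∀ j, TwoSignedPair (encS (m.1 j) (ε j) - encS (m'.1 j) (ε' j))
      (encD (m.1 j) (ε j) - encD (m'.1 j) (ε' j)) := by
    intro j
    by_cases hj : j = k
    · rw [hj, hk, hk']
      rcases hside with ⟨h1, h2⟩ | ⟨h1, h2⟩
      · exact twoSignedPair_T _ _ h1 h2
      · exact twoSignedPair_U _ _ h1 h2
    · exact twoSignedPair_plain _ _ (hpl j hj) (hpl' j hj) _ _
  have vss : (∑ i, (chiZ m.2 i - chiZ m'.2 i) * (t i : ℤ))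
      = (∑ i, chiZ m.2 i * (t i : ℤ)) - ∑ i, chiZ m'.2 i * (t i : ℤ) := by
    rw [← Finset.sum_sub_distrib]; apply Finset.sum_congr rfl; intro i _; ring
  refine hD.not_twoSigned
    (fun j => encS (m.1 j) (ε j) - encS (m'.1 j) (ε' j))
    (fun j => encD (m.1 j) (ε j) - encD (m'.1 j) (ε' j))
    (fun i => chiZ m.2 i - chiZ m'.2 i) ?_ ?_ ?_ ?_
  · exact ⟨fun j => (hpair j).1, fun i => chiZ_sub_bound m.2 m'.2 i⟩
  · refine ⟨fun j => ?_, fun i => ?_⟩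
    · simpa only [Pi.neg_apply] using (hpair j).2
    · have := chiZ_sub_bound m.2 m'.2 i
      simp only [Pi.neg_apply]
      omega
  · have h3 : ((candVal s d t m ε : ℕ) : ℤ) = ((candVal s d t m' ε' : ℕ) : ℤ) := by exact_mod_cast heq
    rw [candVal_cast, candVal_cast] at h3
    have hsplit : (∑ j, ((encS (m.1 j) (ε j) - encS (m'.1 j) (ε' j)) * (s j : ℤ)
          + (encD (m.1 j) (ε j) - encD (m'.1 j) (ε' j)) * (d j : ℤ)))
        = (∑ j, (encS (m.1 j) (ε j) * (s j : ℤ) + encD (m.1 j) (ε j) * (d j : ℤ)))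
          - ∑ j, (encS (m'.1 j) (ε' j) * (s j : ℤ) + encD (m'.1 j) (ε' j) * (d j : ℤ)) := by
      rw [← Finset.sum_sub_distrib]; apply Finset.sum_congr rfl; intro j _; ring
    rw [hsplit, vss]
    linarith
  · by_contra hall
    push Not at hall
    obtain ⟨ha, hb, hc⟩ := hall
    apply hne
    refine Prod.ext (funext fun j => ?_) (eq_of_chiZ_sub_eq_zero m.2 m'.2 hc)
    by_cases hj : j = k
    · rw [hj, hk, hk']
    · have h1 := congrFun ha j
      have h2 := congrFun hb j
      simp only [Pi.zero_apply] at h1 h2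
      exact plain_eq_of_enc_sub_eq_zero _ _ (hpl j hj) (hpl' j hj) _ _ h1 h2

/-- The oriented form used on forcing paths: under an oriented choice of representatives (`IsOriented o ε`), two
distinct same-pair one-`sd` words never receive the same value — whatever the choices at the two words. -/
theorem IsMixedDesign.candVal_ne_of_samePair_oriented {p q : ℕ} {s d : Fin p → ℕ} {t : Fin q → ℕ}
    (hD : IsMixedDesign s d t) (o : Fin p → Bool) {m m' : HWord p q} (hne : m ≠ m') (k : Fin p)
    (hk : m.1 k = 3) (hk' : m'.1 k = 3) (hpl : ∀ j, j ≠ k → m.1 j ≠ 3) (hpl' : ∀ j, j ≠ k → m'.1 j ≠ 3)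
    (ε : HWord p q → (Fin p → Fin 3)) (hε : IsOriented o ε) :
    candVal s d t m (ε m) ≠ candVal s d t m' (ε m') := by
  refine hD.candVal_ne_of_samePair hne k hk hk' hpl hpl' (ε m) (ε m') ?_
  have h1 := hε m k
  have h2 := hε m' k
  cases hok : o k <;> simp [hok] at h1 h2
  · left
    constructor
    · rcases h1 with h | h <;> rw [h] <;> decide
    · rcases h2 with h | h <;> rw [h] <;> decide
  · right
    constructor
    · rcases h1 with h | h <;> rw [h] <;> decide
    · rcases h2 with h | h <;> rw [h] <;> decide

end Summit.MatrixMultiplication.MatrixMultiplication.Theorems
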